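import Summits.Ventures.HodgeRepro2.T5SU11RadialGreen
import Summits.Ventures.HodgeRepro2.T5SU11SphericalDecay
import Summits.Ventures.HodgeRepro2.T5SU11SphericalRegular

/-!
# The resolvent of the radial Laplacian of `SU(1,1)` at `λ > 1`: the Green's solution `G_λ f` built from `φ_λ` and `χ_λ`, and its uniqueness

For `λ > 1` the regular solution `φ_λ(a_t)` (row 446) and the decaying solution `χ_λ` (row 448) of the radial
equation have the normalised Wronskian `sinh 2t · (φ_λ χ_λ′ − φ_λ′ χ_λ) = −1`, so row 451's variation of
parameters applies: for a continuous source `f` supported in `[a, b] ⊂ (0, ∞)`,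

  **`(G_λ f)(t) := −χ_λ(t) ∫_a^t φ_λ(a_s) f(s) sinh 2s ds − φ_λ(a_t) ∫_t^b χ_λ(s) f(s) sinh 2s ds`**  (`sphGreen`)

solves **`sinh 2t · u″ + 2 cosh 2t · u′ = λ(λ − 2) sinh 2t · u + sinh 2t · f`** on `(0, ∞)` (`sphGreen_ode`),
is a multiple of `φ_λ(a_·)` on `(0, a]` — hence BOUNDED at the origin with the limit `−∫_a^b χ_λ f sinh 2s`
(`sphGreen_eq_of_le`, `tendsto_sphGreen_nhdsGT_zero`, `eventually_abs_sphGreen_le`) — and a multiple of `χ_λ` on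
`[b, ∞)` — hence **`(G_λ f)/φ_λ → 0`** at infinity (`sphGreen_eq_of_ge`, `tendsto_sphGreen_div_atTop`). These two
boundary conditions single it out: **every solution `v` of the inhomogeneous equation on `(0, ∞)` that is
bounded as `t → 0⁺` and satisfies `v/φ_λ → 0` at infinity equals `G_λ f`** (`eq_sphGreen_of_ode`): the difference
is a homogeneous solution, a multiple of `φ_λ` by row 446, and the multiple vanishes by the decay. Nothing is
claimed about (N).

Blind lane: Mathlib + the HodgeRepro2 prefix only; no sorry; axioms ⊆ {propext, Classical.choice,
Quot.sound}.
-/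

namespace Summit.Ventures.HodgeRepro2.T5SU11SphericalGreen

open Filter Topology
open Set (Ioi)
open T5SU11Cartan T5SU11SphericalFunction T5SU11SphericalBounds T5SU11SphericalDeriv T5SU11ReductionOfOrder
  T5SU11SphericalSolutionSpaceAll T5SU11SphericalRegular T5SU11SphericalDecay T5SU11RadialGreen

section measure

variable [MeasurableSpace Circle] [BorelSpace Circle]

/-- **The Green's solution at `λ`**: `G_λ f = greenSol` for the basis `φ_λ(a_·), χ_λ`. -/
noncomputable def sphGreen (lam : ℝ) (f : ℝ → ℝ) (a b t : ℝ) : ℝ :=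
  greenSol (fun t => sph lam (hyp t)) (sphDecay lam) f a b t

/-- `(G_λ f)′`. -/
noncomputable def sphGreen' (lam : ℝ) (f : ℝ → ℝ) (a b t : ℝ) : ℝ :=
  greenSol' (deriv fun t => sph lam (hyp t)) (sphDecay' lam) (fun t => sph lam (hyp t)) (sphDecay lam) f a b t

/-- `(G_λ f)″`. -/
noncomputable def sphGreen'' (lam : ℝ) (f : ℝ → ℝ) (a b t : ℝ) : ℝ :=
  greenSol'' (deriv (deriv fun t => sph lam (hyp t))) (sphDecay'' lam) (deriv fun t => sph lam (hyp t))
    (sphDecay' lam) (fun t => sph lam (hyp t)) (sphDecay lam) f a b t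

variable {lam a b : ℝ} {f : ℝ → ℝ} (hlam : 1 < lam) (hf : ContinuousOn f (Ioi 0)) (ha : 0 < a) (hab : a ≤ b)

include hlam hf ha hab in
/-- `(G_λ f)′` is the derivative of `G_λ f` on `(0, ∞)`. -/
theorem hasDerivAt_sphGreen {t : ℝ} (ht : 0 < t) : HasDerivAt (sphGreen lam f a b) (sphGreen' lam f a b t) t :=
  hasDerivAt_greenSol (hφ_sph lam) (fun _ ht => hasDerivAt_sphDecay hlam ht) hf ha hab ht

include hlam hf ha hab in
/-- `(G_λ f)″` is the derivative of `(G_λ f)′` on `(0, ∞)`. -/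
theorem hasDerivAt_sphGreen' {t : ℝ} (ht : 0 < t) :
    HasDerivAt (sphGreen' lam f a b) (sphGreen'' lam f a b t) t :=
  hasDerivAt_greenSol' (hφ_sph lam) (hφ'_sph lam) (fun _ ht => hasDerivAt_sphDecay hlam ht)
    (fun _ ht => hasDerivAt_sphDecay' lam ht) hf ha hab ht

include hlam in
/-- **`G_λ f` solves the inhomogeneous radial equation**
`sinh 2t · u″ + 2 cosh 2t · u′ = λ(λ − 2) sinh 2t · u + sinh 2t · f` on `(0, ∞)`. -/
theorem sphGreen_ode {t : ℝ} (ht : 0 < t) :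
    Real.sinh (2 * t) * sphGreen'' lam f a b t + 2 * Real.cosh (2 * t) * sphGreen' lam f a b t
      = lam * (lam - 2) * Real.sinh (2 * t) * sphGreen lam f a b t + Real.sinh (2 * t) * f t :=
  greenSol_ode (hode_sph lam) (fun _ ht => sphDecay_ode hlam ht) (fun _ ht => wronskian_sphDecay hlam ht) ht

/-! ### The boundary behaviour -/

include hlam hf ha hab in
/-- On `(0, a]`: `G_λ f = −(∫_a^b χ_λ f sinh 2s) · φ_λ(a_·)` when `f` vanishes on `(−∞, a]`. -/
theorem sphGreen_eq_of_le (hfa : ∀ s, s ≤ a → f s = 0) {t : ℝ} (ht : 0 < t) (hta : t ≤ a) :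
    sphGreen lam f a b t = -(∫ s in a..b, sphDecay lam s * f s * Real.sinh (2 * s)) * sph lam (hyp t) :=
  greenSol_eq_of_le (fun _ ht => hasDerivAt_sphDecay hlam ht) hf ha hab hfa ht hta

include hf ha hab in
/-- On `[b, ∞)`: `G_λ f = −(∫_a^b φ_λ f sinh 2s) · χ_λ` when `f` vanishes on `[b, ∞)`. -/
theorem sphGreen_eq_of_ge (hfb : ∀ s, b ≤ s → f s = 0) {t : ℝ} (htb : b ≤ t) :
    sphGreen lam f a b t = -(∫ s in a..b, sph lam (hyp s) * f s * Real.sinh (2 * s)) * sphDecay lam t :=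
  greenSol_eq_of_ge (hφ_sph lam) hf ha hab hfb htb

include hlam hf ha hab in
/-- **`G_λ f` has the limit `−∫_a^b χ_λ f sinh 2s` at the origin.** -/
theorem tendsto_sphGreen_nhdsGT_zero (hfa : ∀ s, s ≤ a → f s = 0) :
    Tendsto (sphGreen lam f a b) (𝓝[>] 0)
      (𝓝 (-(∫ s in a..b, sphDecay lam s * f s * Real.sinh (2 * s)))) := by
  have h := (tendsto_sph_hyp_nhdsGT_zero lam).const_mul (-(∫ s in a..b, sphDecay lam s * f s * Real.sinh (2 * s)))
  rw [mul_one] at h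
  refine h.congr' ?_
  filter_upwards [Ioo_mem_nhdsGT ha] with t ht
  exact (sphGreen_eq_of_le hlam hf ha hab hfa ht.1 ht.2.le).symm

include hlam hf ha hab in
/-- **`G_λ f` is bounded as `t → 0⁺`.** -/
theorem eventually_abs_sphGreen_le (hfa : ∀ s, s ≤ a → f s = 0) :
    ∀ᶠ t in 𝓝[>] (0 : ℝ), |sphGreen lam f a b t| ≤ |∫ s in a..b, sphDecay lam s * f s * Real.sinh (2 * s)| + 1 := by
  filter_upwards [(tendsto_sphGreen_nhdsGT_zero hlam hf ha hab hfa).eventually (eventually_abs_sub_lt _ one_pos)]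
    with t ht
  set L := -(∫ s in a..b, sphDecay lam s * f s * Real.sinh (2 * s)) with hL
  calc |sphGreen lam f a b t| = |(sphGreen lam f a b t - L) + L| := by ring_nf
    _ ≤ |sphGreen lam f a b t - L| + |L| := abs_add_le _ _
    _ ≤ |∫ s in a..b, sphDecay lam s * f s * Real.sinh (2 * s)| + 1 := by
        rw [hL, abs_neg]
        linarith

include hlam hf ha hab in
/-- **`(G_λ f)/φ_λ → 0` at infinity.** -/
theorem tendsto_sphGreen_div_atTop (hfb : ∀ s, b ≤ s → f s = 0) :
    Tendsto (fun t => sphGreen lam f a b t / sph lam (hyp t)) atTop (𝓝 0) := by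
  have h := (tendsto_sphDecay_div_atTop hlam).const_mul
    (-(∫ s in a..b, sph lam (hyp s) * f s * Real.sinh (2 * s)))
  rw [mul_zero] at h
  refine h.congr' ?_
  filter_upwards [eventually_ge_atTop b] with t ht
  rw [sphGreen_eq_of_ge hf ha hab hfb ht]
  ring

/-! ### Uniqueness of the Green's solution -/

include hlam hf ha hab in
/-- **THE GREEN'S SOLUTION IS THE UNIQUE SOLUTION OF THE INHOMOGENEOUS EQUATION THAT IS BOUNDED AT THE ORIGIN AND
DECAYS RELATIVE TO `φ_λ`**: if `v` solves `sinh 2t · v″ + 2 cosh 2t · v′ = λ(λ − 2) sinh 2t · v + sinh 2t · f` on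
`(0, ∞)`, is bounded as `t → 0⁺` and `v/φ_λ → 0` at infinity, then `v = G_λ f` on `(0, ∞)`. -/
theorem eq_sphGreen_of_ode (hfa : ∀ s, s ≤ a → f s = 0) (hfb : ∀ s, b ≤ s → f s = 0)
    {v v' v'' : ℝ → ℝ} (hv : ∀ t, 0 < t → HasDerivAt v (v' t) t) (hv' : ∀ t, 0 < t → HasDerivAt v' (v'' t) t)
    (hvode : ∀ t, 0 < t → Real.sinh (2 * t) * v'' t + 2 * Real.cosh (2 * t) * v' t
      = lam * (lam - 2) * Real.sinh (2 * t) * v t + Real.sinh (2 * t) * f t)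
    {B : ℝ} (hB : ∀ᶠ t in 𝓝[>] (0 : ℝ), |v t| ≤ B)
    (hdecay : Tendsto (fun t => v t / sph lam (hyp t)) atTop (𝓝 0)) {t : ℝ} (ht : 0 < t) :
    v t = sphGreen lam f a b t := by
  -- the difference `w = v − G_λ f` is a homogeneous solution
  set w : ℝ → ℝ := fun t => v t - sphGreen lam f a b t with hw
  have hwd : ∀ t, 0 < t → HasDerivAt w (v' t - sphGreen' lam f a b t) t :=
    fun t ht => (hv t ht).sub (hasDerivAt_sphGreen hlam hf ha hab ht)
  have hwd' : ∀ t, 0 < t → HasDerivAt (fun t => v' t - sphGreen' lam f a b t) (v'' t - sphGreen'' lam f a b t) t :=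
    fun t ht => (hv' t ht).sub (hasDerivAt_sphGreen' hlam hf ha hab ht)
  have hwode : ∀ t, 0 < t → Real.sinh (2 * t) * (v'' t - sphGreen'' lam f a b t)
      + 2 * Real.cosh (2 * t) * (v' t - sphGreen' lam f a b t) = lam * (lam - 2) * Real.sinh (2 * t) * w t := by
    intro t ht
    have e1 := hvode t ht
    have e2 := sphGreen_ode hlam (f := f) (a := a) (b := b) ht
    simp only [hw]
    linear_combination e1 - e2
  -- `w` is bounded at the origin, hence `w = k φ_λ`
  have hwB : ∀ᶠ t in 𝓝[>] (0 : ℝ), |w t| ≤ B + (|∫ s in a..b, sphDecay lam s * f s * Real.sinh (2 * s)| + 1) := by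
    filter_upwards [hB, eventually_abs_sphGreen_le hlam hf ha hab hfa] with t h1 h2
    simp only [hw]
    calc |v t - sphGreen lam f a b t| ≤ |v t| + |sphGreen lam f a b t| := abs_sub _ _
      _ ≤ B + (|∫ s in a..b, sphDecay lam s * f s * Real.sinh (2 * s)| + 1) := add_le_add h1 h2
  have hrep : ∀ s, 0 < s → w s = (w 1 / sph lam (hyp 1)) * sph lam (hyp s) :=
    fun s hs => eq_const_mul_sph_of_bounded lam hwd hwd' hwode hwB hs
  -- the constant vanishes: `w/φ_λ → 0`
  have hwdiv : Tendsto (fun s => w s / sph lam (hyp s)) atTop (𝓝 0) := by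
    have h := hdecay.sub (tendsto_sphGreen_div_atTop hlam hf ha hab hfb)
    rw [sub_zero] at h
    refine h.congr' ?_
    filter_upwards [eventually_gt_atTop 0] with s _
    simp only [hw]
    rw [sub_div]
  have hconst : Tendsto (fun s => w s / sph lam (hyp s)) atTop (𝓝 (w 1 / sph lam (hyp 1))) := by
    refine tendsto_const_nhds.congr' ?_
    filter_upwards [eventually_gt_atTop 0] with s hs
    rw [hrep s hs, mul_div_assoc, div_self (sph_hyp_pos lam s).ne', mul_one]
  have hk : w 1 / sph lam (hyp 1) = 0 := tendsto_nhds_unique hconst hwdiv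
  have hw0 : w t = 0 := by rw [hrep t ht, hk, zero_mul]
  simp only [hw] at hw0
  linarith

end measure

end Summit.Ventures.HodgeRepro2.T5SU11SphericalGreen
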